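import Literature.AnabelianGeometry.EtaleTheta.Discharge.Sec4NonVacuityCoveringRoots
import Literature.AnabelianGeometry.EtaleTheta.Discharge.Sec4Prop42SubRootLawModel
import HarnessLib

/-!
# [EtTh] §4 with a COVERING: the base-level LAWS of the Prop 4.2 (iii)∧(iv) node floor hold at the
# Kummer-tower toy, and the floor closer of record fires (consistency witness, part 9 — laws)

S. Mochizuki, *The étale theta function and its Frobenioid-theoretic manifestations*, Publ. RIMS **45**
(2009) [MochizukiEtTh2009], §4, Prop 4.2 (iii)(iv) p.88 and proof pp.89–90 (PDF); sub-DAG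
`plan/L2/SUBDAG-EtTh-Prop42.md` AMENDMENT v3, §D «NODE READING v3»: at the canonical model
`mkOfModelCanonical` the typed Prop 4.2 (iii) ∧ (iv) is OPEN EXACTLY MODULO six LAWS on the base data
`(D, Φ, B, IG, gS, NH)` — `Φ` divisorial, `hDSpull` ([FrdI] Prop 4.1 (iii) coprimality pull-back), `hR`
(GAP G-w4d044-3: the tempered-meromorphic ROOT LAW of ERRATUM E2, «every `f ∈ B(A)` acquires an `N`-th root
over some Galois covering `A' → A`»), `hE` (G-w4d044-2: [FrdII] Rmk 2.2.1 refinement), `hS` (Def 4.1 (ii)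
outer naturality), `hL` (G-w4d044-1: roots of constants) — by abc-iut-w4-d044's closer
`BiKummerSetting.Prop42Sub.prop42_iii_iv_mkOfModelCanonical_of_laws` (p428253).  That note names THIS toy as
the intended inhabited instance («NV: each law is a plain ∀/∃ statement over a concrete `tf`; abc-iut-w5-d063's
ToyCov is the intended inhabited instance firing the closer»; also abc-iut-w6-d038 2026-08-26T07:08Z «the laws
are coupled; NV = w5-d063's ToyCov firing prop42_iii_iv_mkOfModelCanonical_of_laws»).

CONSISTENCY WITNESS, TOY — PROOF-ONLY (no definition, no named fact, no instance, no `sorry`); sequel of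
`Sec4NonVacuityCovering.lean` (p427822, the data: base `SingleObj ℕ+` of Kummer covers `t ↦ t^N`,
`Φ = ℚ_{≥0}`, `B = ℂˣ × (ℚ_{≥0})^gp`, every object `μ_N`-saturated) and `Sec4NonVacuityCoveringRoots.lean`
(p428415).  What is proved here, for the tempered Frobenioid `ToyCov.temperedFrobenioid` ITSELF (statements
about `(D, Φ, B)`, not about the §4 structure):

* `ToyCov.rootLaw` — **the E2 root law `hR` HOLDS**, supplied by the KUMMER COVER: for every `N`, along the
  degree-`N` cover `b_N : ∗ → ∗`, `B(b_N)(c·t^q) = c·t^{Nq} = (c^{1/N}·t^q)^N` (`ℂˣ` divisible);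
* `ToyCov.constantRootLaw` — **the roots-of-constants law `hL` HOLDS**: an element of `B(A_⊙^bs)` with
  `Div_B = 0` is a constant `c` (fibre-product condition), its pull-back along ANY base arrow is the same
  constant, and `c = (c^{1/N})^N`;
* `ToyCov.refinementLaw` (`hE`, refinement `ψ = id`, REAL `μ_N`-saturation), `ToyCov.naturalityLaw` (`hS`,
  trivial Galois surjections), `ToyCov.coprime_pull` (p428415, `hDSpull`), `ToyCov.divisorMonoid_isDivisorial`
  (p427822) — the other four laws;
* `ToyCov.laws_and_prop42_iii_iv` — **the six laws hold TOGETHER at one explicit `tf`, and the node-floor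
  closer `prop42_iii_iv_mkOfModelCanonical_of_laws` FIRES on them**, returning the typed Prop 4.2 (iii) ∧ (iv)
  at `ToyCov.biKummerSetting` (a second, law-level derivation of `ToyCov.prop42_iii` / `ToyCov.prop42_iv`);
* one level deeper (abc-iut-w4-d044's `Sec4Prop42SubRootLawModel.lean`, p432007: `hR ⇐ {hR₀, hTF, Φ perfect}`
  through the fibre product `B = B₀^Λ ×_{(Φ^{ℝ-log})^gp} Φ^gp`): `ToyCov.baseRootLaw` — **the `B₀^Λ`-level root
  law `hR₀` HOLDS** (the Kummer cover acting on `B₀ = ℂˣ × (ℚ_{≥0})^gp` directly: `(c, q) ↦ (c, Nq)`),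
  `ToyCov.pow_injective_ΦR_gp` — **`hTF` HOLDS** (`(Φ₀^ℝ)^gp = (ℚ_{≥0})^gp` is perfect, abc-iut-L1's
  `isPerfect_grothendieckGroup`), and `ToyCov.baseLaws_and_prop42_iii_iv` — the deeper floor closer
  `prop42_iii_iv_mkOfModelCanonical_of_baseRootLaw` FIRES: the floor {`Φ` divisorial, `hDSpull`, `hR₀`, `hTF`,
  `hE`, `hS`, `hL`} is jointly satisfiable as well.

So the reduction «(iii)∧(iv) ⇐ laws» of AMENDMENT v3 is not vacuous: its binders are jointly satisfiable
together with the setting axioms (monoid type `ℤ`, `Φ` perfect, canonical model).  HONEST LIMITS as in parts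
6–8: one base object (pull-backs bijective, exponents divisible, so `N`-th roots of `t^q` would also exist
without the cover — the cover-free toy `Toy.not_rootOverCovering` p430171 shows the CONSTANTS are what the
root law needs there); trivial [FrdI] vocabularies; `(N, H)`-slot `True`; not a curve; consistency ≠
faithfulness; typed ≠ proved.  Nothing here bears on, or takes a side on, [IUTchIII] Cor. 3.12.
-/

noncomputable section

namespace Literature.AnabelianGeometry.EtaleTheta

open CategoryTheory Opposite Literature.AlgebraicGeometry.Frobenioids
open scoped NNRat

namespace ToyCov

section Laws

/-- `ℂˣ` is divisible: every constant has an `N`-th root. [folklore] -/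
private theorem exists_pow_eq_const (c : ℂˣ) (N : ℕ+) : ∃ c' : ℂˣ, c' ^ (N : ℕ) = c := by
  obtain ⟨z, hz⟩ := IsAlgClosed.exists_pow_nat_eq (c : ℂ) (PNat.pos N)
  have hu : IsUnit z := (isUnit_pow_iff (PNat.ne_zero N)).mp (hz ▸ c.isUnit)
  exact ⟨hu.unit, Units.ext (by simp [hz])⟩

/-- Pull-back of divisors along the degree-`N` Kummer cover of ANY base object is the `N`-th power map on
`Φ^gp`. [cite: MochizukiEtTh2009, Def 3.3 p.73] -/
theorem gpMap_pull_cover' (A : Base) (N : ℕ+)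
    (ξ : Algebra.GrothendieckGroup (temperedFrobenioid.Φ.carrier (op A))) :
    gpMap (temperedFrobenioid.Φ.pull (cover A A N).op) ξ = ξ ^ (N : ℕ) := by
  obtain rfl : A = pt := Subsingleton.elim _ _
  exact gpMap_pull_cover N ξ

/-- **The tempered-meromorphic ROOT LAW `hR` (ERRATUM E2, GAP G-w4d044-3) HOLDS at the Kummer-tower toy**,
by the Kummer cover: for every `N ≥ 1`, every base object `A` and every `f = c·t^q ∈ B(A)`, along the
degree-`N` cover `b_N : A → A` one has `B(b_N) f = c·t^{Nq} = (c^{1/N}·t^q)^N`.  (Stated exactly in the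
shape consumed by `Prop42Sub.prop42_iii_iv_mkOfModelCanonical_of_laws`, with `IG := ⊤`.)
[cite: MochizukiEtTh2009, Prop 4.2 p.89] -/
theorem rootLaw (N : ℕ+) (A : Base) (_hA : True) (f : temperedFrobenioid.ratFnFunctor.obj (op A)) :
    ∃ (A' : Base) (_ : True) (b : A' ⟶ A) (g : temperedFrobenioid.ratFnFunctor.obj (op A')),
      g ^ (N : ℕ) = pull temperedFrobenioid.ratFnFunctor b f := by
  obtain ⟨c', hc'⟩ := exists_pow_eq_const f.1.1.1 N
  refine ⟨A, trivial, cover A A N, ⟨((c', f.1.1.2), f.1.2), f.2⟩, Subtype.ext ?_⟩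
  change ((c', f.1.1.2), f.1.2) ^ (N : ℕ) = (temperedFrobenioid.ratFnPull (cover A A N).op f).1
  rw [TemperedFrobenioid.coe_ratFnPull, Prod.pow_mk, Prod.pow_mk, hc', gpMap_pull_cover']
  rfl

/-- An element of `B(A)` with `Div_B = 0` is a constant: both exponent components are trivial (the second
by `Div_B`, the first by the fibre-product condition `Div^Λ = Div_B` in `(Φ^{ℝ-log})^gp`).
[cite: MochizukiEtTh2009, Def 3.6 p.77] -/
theorem eq_cnst_of_divB_eq_one (A : temperedFrobenioid.category)
    (ξ : temperedFrobenioid.ratFnFunctor.obj (op A.base))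
    (hξ : divB temperedFrobenioid.divisorMonoid temperedFrobenioid.ratFnFunctor temperedFrobenioid.divBNatTrans
      (op A.base) ξ = 1) :
    ξ = cnst A ξ.1.1.1 := by
  have h2 : ξ.1.2 = 1 := hξ
  have h12 : ξ.1.1.2 = 1 := by
    have hrel := ξ.2
    change (_ : Algebra.GrothendieckGroup (Multiplicative ℚ≥0)) = temperedFrobenioid.ΦgpToRlog _ _ at hrel
    rw [h2, map_one] at hrel
    exact hrel
  exact Subtype.ext (Prod.ext (Prod.ext rfl h12) h2)

/-- Constants pull back to constants along every base arrow. [cite: MochizukiEtTh2009, Def 3.3 p.73] -/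
theorem pull_cnst (A A' : temperedFrobenioid.category) (g : A'.base ⟶ A.base) (c : ℂˣ) :
    pull temperedFrobenioid.ratFnFunctor g (cnst A c) = cnst A' c := by
  apply Subtype.ext
  change (temperedFrobenioid.ratFnPull g.op (cnst A c)).1 = (cnst A' c).1
  rw [TemperedFrobenioid.coe_ratFnPull]
  change (((fnFunctor.map g.op).hom (c, 1) : Fn), gpMap (temperedFrobenioid.Φ.pull g.op) 1) = ((c, 1), 1)
  rw [fnFunctor_map_apply, one_pow, map_one]
  rfl

/-- Powers of constants are constants. [cite: MochizukiEtTh2009, Def 3.6 p.77] -/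
theorem cnst_pow (A : temperedFrobenioid.category) (c : ℂˣ) (n : ℕ) : cnst A c ^ n = cnst A (c ^ n) := by
  have h := congrArg Units.val (map_pow (cnstUnitHom A) c n)
  rw [Units.val_pow_eq_pow_val] at h
  exact h.symm

/-- **The roots-of-constants law `hL` (GAP G-w4d044-1) HOLDS at the Kummer-tower toy**: a constant
`ξ = c ∈ B(A_⊙^bs)` (`Div_B ξ = 0`) pulls back along any base arrow `g : A''^bs → A_⊙^bs` to the constant
`c = (c^{1/N})^N ∈ B(A''^bs)`.  (Stated exactly in the shape consumed by
`Prop42Sub.prop42_iii_iv_mkOfModelCanonical_of_laws`; the Frobenius-triviality and `(N,H)`-hypotheses are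
not needed here.) [cite: MochizukiEtTh2009, Prop 4.2 p.90] -/
theorem constantRootLaw (A'' : temperedFrobenioid.category) (N : ℕ+) (g : A''.base ⟶ Aodot.base)
    (ξ : temperedFrobenioid.ratFnFunctor.obj (op Aodot.base))
    (_hft : PreFrobenioid.IsFrobeniusTrivial temperedFrobenioid.toElem A'') (_hNH : True)
    (hξ : divB temperedFrobenioid.divisorMonoid temperedFrobenioid.ratFnFunctor temperedFrobenioid.divBNatTrans
      (op Aodot.base) ξ = 1) :
    ∃ ζ : temperedFrobenioid.ratFnFunctor.obj (op A''.base), ζ ^ (N : ℕ) = pull temperedFrobenioid.ratFnFunctor g ξ := by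
  obtain ⟨c', hc'⟩ := exists_pow_eq_const ξ.1.1.1 N
  have hξ' := eq_cnst_of_divB_eq_one Aodot ξ hξ
  refine ⟨cnst A'' c', ?_⟩
  rw [hξ', pull_cnst, cnst_pow, hc']

/-- **The refinement law `hE` (GAP G-w4d044-2, [FrdII] Rmk 2.2.1) HOLDS at the Kummer-tower toy** with the
identity refinement: every object is already `μ_N`-saturated for every `N` (REAL, `ToyCov.isMuSaturated`),
Galois-slot and `(N,H)`-slot `True`. [cite: MochizukiEtTh2009, Prop 4.2 p.90] -/
theorem refinementLaw (N : ℕ+) (A' : temperedFrobenioid.category)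
    (_hft : PreFrobenioid.IsFrobeniusTrivial temperedFrobenioid.toElem A') (_hG : True) :
    ∃ (A'' : temperedFrobenioid.category) (ψ : A'' ⟶ A'),
      PreFrobenioid.IsPullbackMorphism temperedFrobenioid.toElem ψ ∧ True ∧
        temperedFrobenioid.IsMuSaturated A'' N ∧ True :=
  ⟨A', 𝟙 A', ModelFrobenioid.isPullbackMorphism_of divisorMonoid_isDivisorial ratFnFunctor_isGroupLike rfl rfl,
    trivial, isMuSaturated A' N, trivial⟩

/-- **The Def 4.1 (ii) naturality law `hS` HOLDS at the Kummer-tower toy**: the Galois surjections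
`Π^tp_X ↠ Aut_D(−) = 1` are trivial, so every base arrow is equivariant (with `c := 1`).
[cite: MochizukiEtTh2009, Def 4.1 p.87] -/
theorem naturalityLaw ⦃A B : Base⦄ (_hA : True) (_hB : True) (b : B ⟶ A) :
    ∃ c : Toy.temperedGroup.Pi, ∀ g : Toy.temperedGroup.Pi,
      ((1 : Toy.temperedGroup.Pi →* Aut B) g).hom ≫ b =
        b ≫ ((1 : Toy.temperedGroup.Pi →* Aut A) (c * g * c⁻¹)).hom :=
  ⟨1, fun g => by
    rw [MonoidHom.one_apply, MonoidHom.one_apply]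
    exact (Category.id_comp _).trans (Category.comp_id _).symm⟩

/-- **The six base-level laws of the Prop 4.2 (iii)∧(iv) node floor hold TOGETHER at the Kummer-tower toy,
and abc-iut-w4-d044's floor closer `Prop42Sub.prop42_iii_iv_mkOfModelCanonical_of_laws` FIRES on them**:
the E2 root law `hR` and the roots-of-constants law `hL` (displayed), with `Φ` divisorial, `hDSpull`, `hE`,
`hS`, yield the typed Prop 4.2 (iii) ∧ (iv) at `ToyCov.biKummerSetting` BY THE LAW-LEVEL REDUCTION — its
binders are jointly satisfiable with the setting axioms. [cite: MochizukiEtTh2009, Prop 4.2 p.88] -/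
theorem laws_and_prop42_iii_iv :
    (∀ (N : ℕ+) (A : Base), True → ∀ f : temperedFrobenioid.ratFnFunctor.obj (op A),
      ∃ (A' : Base) (_ : True) (b : A' ⟶ A) (g : temperedFrobenioid.ratFnFunctor.obj (op A')),
        g ^ (N : ℕ) = pull temperedFrobenioid.ratFnFunctor b f) ∧
    (∀ (A'' : temperedFrobenioid.category) (N : ℕ+) (g : A''.base ⟶ Aodot.base)
      (ξ : temperedFrobenioid.ratFnFunctor.obj (op Aodot.base)),
      PreFrobenioid.IsFrobeniusTrivial temperedFrobenioid.toElem A'' → True →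
      divB temperedFrobenioid.divisorMonoid temperedFrobenioid.ratFnFunctor temperedFrobenioid.divBNatTrans
        (op Aodot.base) ξ = 1 →
        ∃ ζ : temperedFrobenioid.ratFnFunctor.obj (op A''.base),
          ζ ^ (N : ℕ) = pull temperedFrobenioid.ratFnFunctor g ξ) ∧
    biKummerSetting.Prop42_iii (fun {_ _} φ x => temperedFrobenioid.pullFracModel φ x) ∧
    biKummerSetting.Prop42_iv (fun φ x => temperedFrobenioid.pullFracModel φ x) :=
  ⟨rootLaw, constantRootLaw,
    BiKummerSetting.Prop42Sub.prop42_iii_iv_mkOfModelCanonical_of_laws Toy.temperedGroup temperedFrobenioid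
      temperedFrobenioid_monoidType temperedFrobenioid_isPerfect (fun _ => True) (fun _ _ => 1)
      galoisSurj_surjective (fun _ _ _ => True) Aodot isFrobeniusTrivial_Aodot trivial divisorMonoid_isDivisorial
      (fun e _ _ h y hya hyb => coprime_pull e h y hya hyb) rootLaw refinementLaw naturalityLaw constantRootLaw⟩

/-! ### One level deeper: the `B₀^Λ`-level root law `hR₀` and `hTF` (abc-iut-w4-d044, p432007) -/

/-- **The `B₀^Λ`-level root law `hR₀` (the reduced form of GAP G-w4d044-3) HOLDS at the Kummer-tower toy**:
the degree-`N` Kummer cover acts on `B₀ = B₀^Λ = ℂˣ × (ℚ_{≥0})^gp` by `(c, q) ↦ (c, N q)`, and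
`(c, Nq) = (c^{1/N}, q)^N`. [cite: MochizukiEtTh2009, Def 3.6 p.77] -/
theorem baseRootLaw (N : ℕ+) (A : Base) (_hA : True)
    (b : realified.BΛ.obj (op (temperedFrobenioid.base.obj A))) :
    ∃ (A' : Base) (_ : True) (c : A' ⟶ A) (b' : realified.BΛ.obj (op (temperedFrobenioid.base.obj A'))),
      b' ^ (N : ℕ) = (realified.BΛ.map (temperedFrobenioid.base.map c).op).hom b := by
  obtain ⟨c', hc'⟩ := exists_pow_eq_const (b : Fn).1 N
  refine ⟨A, trivial, cover A A N, ((c', (b : Fn).2) : Fn), ?_⟩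
  change ((c', (b : Fn).2) : Fn) ^ (N : ℕ) = (fnFunctor.map (cover A A N).op).hom b
  rw [fnFunctor_map_apply, Prod.pow_mk, hc']
  rfl

/-- **`hTF` HOLDS at the Kummer-tower toy**: `N`-th powers (`N ≥ 1`) are injective in
`(Φ^{ℝ-log})^gp(A) = (ℚ_{≥0})^gp`, the groupification of a perfect monoid being perfect (abc-iut-L1's
`isPerfect_grothendieckGroup`). [cite: MochizukiFrdI2008, §0 p.11] -/
theorem pow_injective_ΦR_gp (A : Base) (N : ℕ) (hN : 0 < N) :
    Function.Injective fun x : Algebra.GrothendieckGroup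
      (realified.ΦR.obj (op (temperedFrobenioid.base.obj A))) => x ^ N :=
  ((isPerfect_grothendieckGroup (P := Multiplicative ℚ≥0) isPerfect_multiplicative_nnrat).bijective_pow N hN).1

/-- **The deeper floor {`Φ` divisorial, `hDSpull`, `hR₀`, `hTF`, `hE`, `hS`, `hL`} holds TOGETHER at the
Kummer-tower toy, and abc-iut-w4-d044's closer `Prop42Sub.prop42_iii_iv_mkOfModelCanonical_of_baseRootLaw`
(p432007: `hR ⇐ {hR₀, hTF, Φ perfect}` through the fibre product `B = B₀^Λ ×_{(Φ^{ℝ-log})^gp} Φ^gp`)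
FIRES on it** — `hR₀` and `hTF` displayed. [cite: MochizukiEtTh2009, Prop 4.2 p.88] -/
theorem baseLaws_and_prop42_iii_iv :
    (∀ (N : ℕ+) (A : Base), True → ∀ b : realified.BΛ.obj (op (temperedFrobenioid.base.obj A)),
      ∃ (A' : Base) (_ : True) (c : A' ⟶ A) (b' : realified.BΛ.obj (op (temperedFrobenioid.base.obj A'))),
        b' ^ (N : ℕ) = (realified.BΛ.map (temperedFrobenioid.base.map c).op).hom b) ∧
    (∀ (A : Base) (N : ℕ), 0 < N → Function.Injective fun x : Algebra.GrothendieckGroup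
      (realified.ΦR.obj (op (temperedFrobenioid.base.obj A))) => x ^ N) ∧
    biKummerSetting.Prop42_iii (fun {_ _} φ x => temperedFrobenioid.pullFracModel φ x) ∧
    biKummerSetting.Prop42_iv (fun φ x => temperedFrobenioid.pullFracModel φ x) :=
  ⟨baseRootLaw, pow_injective_ΦR_gp,
    BiKummerSetting.Prop42Sub.prop42_iii_iv_mkOfModelCanonical_of_baseRootLaw Toy.temperedGroup
      temperedFrobenioid temperedFrobenioid_monoidType temperedFrobenioid_isPerfect (fun _ => True) (fun _ _ => 1)
      galoisSurj_surjective (fun _ _ _ => True) Aodot isFrobeniusTrivial_Aodot trivial divisorMonoid_isDivisorial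
      (fun e _ _ h y hya hyb => coprime_pull e h y hya hyb) pow_injective_ΦR_gp baseRootLaw refinementLaw
      naturalityLaw constantRootLaw⟩

end Laws

end ToyCov

end Literature.AnabelianGeometry.EtaleTheta

end
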